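import Literature.AlgebraicGeometry.HodgeTheory.ComplexTorusIntegralHodgeClassesKunnethProjectorsNaturality
import HarnessLib

/-!
# The Künneth projectors commute with the graphs `Γ_f`: `(f × 1_Y)^* π_{t,Y} = (1_X × f)_* π_{t′,X}`, `π_{t,Y} ∘ Γ_f = Γ_f ∘ π_{t′,X}`

Sequel of g29-#7 (`ComplexTorusIntegralHodgeClassesKunnethProjectorsNaturality`: Prop. 6.3.9 (b) `ᵗΓ_f ∘ π_{s,Y} = π_{s,X} ∘ ᵗΓ_f`, i.e. `(1_Y × f)^* π_{s,Y} =
(f × 1_X)_* π_{s,X}`). Transposing (Fulton Prop. 16.1.1 (b) `(β ∘ α)′ = α′ ∘ β′`, Lange Prop. 6.3.10 `ᵗπ_i = π_{2g−i}`) gives the companion statement for the graph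
`Γ_f` itself: `π_{2g_Y−s,Y} ∘ Γ_f = Γ_f ∘ π_{2g_X−s,X}` — a homomorphism `f : X → Y` of complex tori maps the Künneth piece `h^{t′}(X)` cut out by `π_{t′,X}` to the piece
`h^t(Y)` with `t + 2g_X = t′ + 2g_Y` (the grading by CODEGREE is preserved by `Γ_{f*}`, the grading by degree by `ᵗΓ_f = Γ_f^*`). On the integral carriers:

* §1 **`integralHodgeClassesPullbackHom_prodMap_id_kunnethProjector'`** — `(f × 1_Y)^* π_{t,Y} = (1_X × f)_* π_{t′,X}` in `Hdg^{g_Y}(X × Y, ℤ)` for `t′ + 2g_Y = t + 2g_X`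
  (g29-#7 pushed forward along `τ : Y × X ⥲ X × Y`; `τ_* π_s = π_{2g−s}`, g29-#5);
* §2 **`integralHodgeClassesCorrComp_graphClass_kunnethProjector`** — verbatim `π_{t,Y} ∘ Γ_f = Γ_f ∘ π_{t′,X}` in Fulton's composition (g27-#5
  `integralHodgeClassesCorrComp_graphClass_left/right`: `β ∘ Γ_f = (f × 1)^*β`, `Γ_g ∘ α = (1 × g)_* α`).

## References
* [Lange2023AbelianVarietiesComplex] H. Lange, Abelian Varieties over the Complex Numbers, Springer 2023, §6.3.4 Prop. 6.3.9 (b) (p0318 L1–L7), Prop. 6.3.10 (p0318 L48),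
  §6.2.2 Prop. 6.2.10.
* [Fulton1998] W. Fulton, Intersection Theory, 2nd ed., Springer 1998, §16.1 Prop. 16.1.1 (b), (c) (p0293 L22–L25).
-/

noncomputable section

open CategoryTheory Function

namespace Literature.AlgebraicGeometry.HodgeTheory

open Literature.AlgebraicGeometry.Motives Literature.AlgebraicGeometry.Motives.HodgeStructure
open Literature.Geometry.Kaehler Literature.Geometry.Kaehler.ComplexTorus

namespace ComplexTorusCat

section Graphs

variable {X Y : ComplexTorusCat} (f : X ⟶ Y) {gX gY gXX gYY gYX : ℕ}
  (eX : Fin (2 * gX) ≃ X.toIsog.ι) (eXX : Fin (2 * gXX) ≃ (prodObj X X).toIsog.ι)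
  (hX0 : 2 * gX + 2 * 0 = 2 * gX) (hgX : gX + gX = 2 * gX) (hcX : 2 * gX + 2 * gX = 2 * gXX) (hgXX : gXX + gXX = 2 * gXX)
  (eY : Fin (2 * gY) ≃ Y.toIsog.ι) (eYY : Fin (2 * gYY) ≃ (prodObj Y Y).toIsog.ι)
  (hY0 : 2 * gY + 2 * 0 = 2 * gY) (hgY : gY + gY = 2 * gY) (hcY : 2 * gY + 2 * gY = 2 * gYY) (hgYY : gYY + gYY = 2 * gYY)
  (eXY : Fin (2 * gYX) ≃ (prodObj X Y).toIsog.ι) (hl' : 2 * gX + 2 * gY = 2 * gYX) (hgYX : gYX + gYX = 2 * gYX)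

/-! ### §1 `(f × 1_Y)^* π_{t,Y} = (1_X × f)_* π_{t′,X}` -/

/-- **`(f × 1_Y)^* π_{t,Y} = (1_X × f)_* π_{t′,X}` in `Hdg^{g_Y}(X × Y, ℤ)` whenever `t′ + 2g_Y = t + 2g_X`** — the Künneth projectors commute with the graph
correspondence `Γ_f` (`β ∘ Γ_f = (f × 1)^*β`, `Γ_f ∘ α = (1 × f)_* α`), with the codegree preserved: Prop. 6.3.9 (b) (g29-#7: `(1_Y × f)^* π_{s,Y} = (f × 1_X)_* π_{s,X}`,
`s = 2g_Y − t = 2g_X − t′`) pushed forward along the exchange `τ : Y × X ⥲ X × Y` (`τ_* = τ^*`, `(u × v) ≫ τ = τ ≫ (v × u)`, `τ_* π_s = π_{2g−s}` — Prop. 6.3.10).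
[cite: Lange2023AbelianVarietiesComplex, §6.3.4 Prop. 6.3.9 (b) (p0318 L1–L7) and Prop. 6.3.10 (p0318 L48)] [cite: Fulton1998, §16.1 Prop. 16.1.1 (b) (p0293 L22–L23)] -/
theorem integralHodgeClassesPullbackHom_prodMap_id_kunnethProjector' {t t' : ℕ} (htt : t' + 2 * gY = t + 2 * gX) :
    integralHodgeClassesPullbackHom (prodMap f (𝟙 Y)) gY (kunnethProjector Y eY eYY hY0 hgY hcY hgYY t) =
      integralHodgeClassesPushforward gX gY (prodMap (𝟙 X) f) eXX eXY hcX hgXX hl' hgYX (kunnethProjector X eX eXX hX0 hgX hcX hgXX t') := by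
  by_cases ht : t ≤ 2 * gY
  · obtain ⟨s, hsY, hsX⟩ : ∃ s : ℕ, s + t = 2 * gY ∧ s + t' = 2 * gX := ⟨2 * gY - t, by omega, by omega⟩
    let eYX : Fin (2 * gYX) ≃ (prodObj Y X).toIsog.ι := eXY.trans (Equiv.sumComm _ _)
    have key := congrArg (integralHodgeClassesPushforward gY gY (swapHom Y X) eYX eXY hl' hgYX hl' hgYX)
      (integralHodgeClassesPullbackHom_prodMap_id_kunnethProjector f eX eXX hX0 hgX hcX hgXX eY eYY hY0 hgY hcY hgYY eYX hl' hgYX s)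
    rw [integralHodgeClassesPushforward_swapHom Y X eYX eXY hl' hgYX, ← integralHodgeClassesPullbackHom_comp (swapHom X Y) gY (prodMap (𝟙 Y) f),
      ← prodMap_swapHom, integralHodgeClassesPullbackHom_comp, ← integralHodgeClassesPushforward_swapHom Y Y eYY eYY hcY hgYY,
      integralHodgeClassesPushforward_swapHom_kunnethProjector Y eY eYY hY0 hgY hcY hgYY s t hsY,
      ← integralHodgeClassesPushforward_comp gX gY (prodMap f (𝟙 X)) eXX eYX hcX hgXX hl' hgYX gY (swapHom Y X) eXY hl' hgYX, prodMap_swapHom,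
      integralHodgeClassesPushforward_comp gX gX (swapHom X X) eXX eXX hcX hgXX hcX hgXX gY (prodMap (𝟙 X) f) eXY hl' hgYX,
      integralHodgeClassesPushforward_swapHom_kunnethProjector X eX eXX hX0 hgX hcX hgXX s t' hsX] at key
    exact key
  · rw [kunnethProjector_eq_zero_of_lt Y eY eYY hY0 hgY hcY hgYY (not_le.1 ht), kunnethProjector_eq_zero_of_lt X eX eXX hX0 hgX hcX hgXX (by omega : 2 * gX < t'),
      map_zero, map_zero]

/-! ### §2 `π_{t,Y} ∘ Γ_f = Γ_f ∘ π_{t′,X}` -/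

variable {gT₁ gT₂ c₁ c₂ : ℕ} (hT₁ : gY + gYX = gT₁) (hT₂ : gXX + gY = gT₂) (eT₁ : Fin (2 * gT₁) ≃ (prodObj X (prodObj Y Y)).toIsog.ι)
  (eT₂ : Fin (2 * gT₂) ≃ (prodObj X (prodObj X Y)).toIsog.ι) (hgT₁ : gT₁ + gT₁ = 2 * gT₁) (hgT₂ : gT₂ + gT₂ = 2 * gT₂) (hbc₁ : gY + gY = c₁) (hac₂ : gX + gY = c₂)
  (hr₁ : 2 * gX + 2 * c₁ = 2 * gT₁) (hr₂ : 2 * gX + 2 * c₂ = 2 * gT₂)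

include hT₁ hT₂ in
/-- **`π_{t,Y} ∘ Γ_f = Γ_f ∘ π_{t′,X}` VERBATIM (`t′ + 2g_Y = t + 2g_X`)** in Fulton's composition `β ∘ α = p₁₃*(p₁₂^*α · p₂₃^*β)` — the composites formed on `X × (Y × Y)` and
`X × (X × Y)` in any frames `eT₁`, `eT₂`, with `[Γ_f] = (1, f)_* 1_X` (g27-#3): g27-#5's Prop. 16.1.1 (c) `β ∘ Γ_f = (f × 1_Y)^*β`, `Γ_f ∘ α = (1_X × f)_* α` and §1.
[cite: Lange2023AbelianVarietiesComplex, §6.3.4 Prop. 6.3.9 (b) (p0318 L1–L7) and Prop. 6.3.10 (p0318 L48)] [cite: Fulton1998, §16.1 Prop. 16.1.1 (c) (p0293 L24–L25)] -/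
theorem integralHodgeClassesCorrComp_graphClass_kunnethProjector {t t' : ℕ} (htt : t' + 2 * gY = t + 2 * gX) :
    integralHodgeClassesPushforward c₁ gY (liftHom (fstHom X (prodObj Y Y)) (sndHom X (prodObj Y Y) ≫ sndHom Y Y)) eT₁ eXY hr₁ hgT₁ hl' hgYX
        (integralHodgeClassesCup (prodObj X (prodObj Y Y)).toIsog.Φ hbc₁
          (integralHodgeClassesPullbackHom (liftHom (fstHom X (prodObj Y Y)) (sndHom X (prodObj Y Y) ≫ fstHom Y Y)) gY
            (integralHodgeClassesPushforward 0 gY (graphHom f) eX eXY hX0 hgX hl' hgYX (unitIntegralHodgeClass X)))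
          (integralHodgeClassesPullbackHom (sndHom X (prodObj Y Y)) gY (kunnethProjector Y eY eYY hY0 hgY hcY hgYY t))) =
      integralHodgeClassesPushforward c₂ gY (liftHom (fstHom X (prodObj X Y)) (sndHom X (prodObj X Y) ≫ sndHom X Y)) eT₂ eXY hr₂ hgT₂ hl' hgYX
        (integralHodgeClassesCup (prodObj X (prodObj X Y)).toIsog.Φ hac₂
          (integralHodgeClassesPullbackHom (liftHom (fstHom X (prodObj X Y)) (sndHom X (prodObj X Y) ≫ fstHom X Y)) gX
            (kunnethProjector X eX eXX hX0 hgX hcX hgXX t'))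
          (integralHodgeClassesPullbackHom (sndHom X (prodObj X Y)) gY
            (integralHodgeClassesPushforward 0 gY (graphHom f) eX eXY hX0 hgX hl' hgYX (unitIntegralHodgeClass X)))) := by
  rw [integralHodgeClassesCorrComp_graphClass_left hT₁ f eX eY eXY eXY eT₁ hX0 hgX hl' hgYX (by omega : 2 * gYX + 2 * 0 = 2 * gYX) hgYX
      (by omega : 2 * gYX + 2 * gY = 2 * gT₁) hgT₁ hbc₁ hl' hr₁,
    integralHodgeClassesCorrComp_graphClass_right hT₂ f eX eY eXX eXY eXY eT₂ hX0 hgX hl' hgYX (by omega : 2 * gXX + 2 * 0 = 2 * gXX) hgXX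
      (by omega : 2 * gXX + 2 * gY = 2 * gT₂) hgT₂ hgYX hac₂ hcX hr₂ hl',
    integralHodgeClassesPullbackHom_prodMap_id_kunnethProjector' f eX eXX hX0 hgX hcX hgXX eY eYY hY0 hgY hcY hgYY eXY hl' hgYX htt]

end Graphs

end ComplexTorusCat

end Literature.AlgebraicGeometry.HodgeTheory
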